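import Literature.Probability.RandomPlanarGeometry.ConformalRestrictionProofs
import Literature.Probability.RandomPlanarGeometry.SLEExistence
import Literature.Probability.RandomPlanarGeometry.HalfPlaneAutomorphism
import Literature.Probability.RandomPlanarGeometry.SimpleCurves
import HarnessLib

/-!
# `Literature.Probability.RandomPlanarGeometry.LawlerSchrammWerner2003` reduced to printed theorems

Level 0 bookkeeping of the decomposition of the named fact `Literature.Probability.RandomPlanarGeometry.LawlerSchrammWerner2003`
([LSW] p. 5 result 2, transposed; file `ConformalRestriction`, plan in
`ConformalRestrictionProofs`):

* G. F. Lawler, O. Schramm, W. Werner, *Conformal restriction: the chordal case*, J. Amer. Math.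
  Soc. **16** (2003) 917–955, arXiv:math/0209343 (**[LSW]**).

`ConformalRestrictionProofs.LawlerSchrammWerner2003_of_facts` derives the fact from nine named
facts, five of which are tree-level glue statements about SLE in Dobrushin domains that other
files have meanwhile reduced to the PRINTED classical theorems:

* `exists_isSLECurve` ⟸ `SLEExistence.exists_isSLECurve_of_disc_facts` (Rohde–Schramm Thm. 5.1
  and Thm. 7.1, Lawler–Schramm–Werner 2004 Thm. 4.7, Jordan–Schoenflies, the Riemann mapping
  theorem and Carathéodory's theorem in disc form, marginal measurability of the trace);
* `IsSLECurve.map_eq` ⟸ `SLEProofs.IsSLECurve.map_eq_of_facts` with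
  `HalfPlaneAutomorphism.IsChordalUniformizing.exists_eq_trans_smul_of_disc` and
  `CaratheodoryHalfPlane.JordanDomain.continuousOn_boundaryExtension_of_disc` (Carathéodory,
  disc form; SLE scaling in law);
* `JordanDomain.exists_hasBoundaryValue`, `JordanDomain.mapsTo_boundaryExtension` ⟸
  `CaratheodoryHalfPlane.JordanDomain.exists_hasBoundaryValue_of_disc`,
  `.mapsTo_boundaryExtension_of_disc` (Carathéodory, disc form);
* `CurveClass.measurableSet_simple` — PROVED (`SimpleCurves.measurableSet_simple_holds`).

`Literature.Probability.RandomPlanarGeometry.LawlerSchrammWerner2003_of_printed_facts` records the resulting dependency of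
`Literature.Probability.RandomPlanarGeometry.LawlerSchrammWerner2003` on: the two [LSW] facts `LawlerSchrammWerner2003_unique`
(Prop. 3.3 with Lemma 3.2, Thm. 7.3, Cor. 8.6, transposed) and
`IsSLELaw.hullRestriction_eightThirds` (Thm. 6.1, transposed; its half-plane form is being
assembled from the verbatim `sle_restriction_eightThirds` in `RestrictionHulls`,
`RestrictionSemigroup`), and otherwise only on printed theorems of the classical literature —
Rohde–Schramm 2005 (Thm. 5.1 trace, Thm. 6.1 simple phase, Thm. 7.1 transience, §2 scaling),
Lawler–Schramm–Werner 2004 Thm. 4.7 (SLE₈ trace), the Riemann mapping theorem (Ahlfors Ch. 6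
Thm. 1), Carathéodory's theorem (Pommerenke Thm. 2.6), the Jordan–Schoenflies theorem (simple
connectivity of Jordan domains) and the Kolmogorov extension theorem behind the pre-Wiener
measure.
-/

noncomputable section

open MeasureTheory
open scoped NNReal

namespace Literature.Probability.RandomPlanarGeometry

/-- **`Literature.Probability.RandomPlanarGeometry.LawlerSchrammWerner2003` from the two [LSW] facts and printed classical theorems.**
Hypotheses: `hW` Kolmogorov extension (the pre-Wiener measure is the projective limit of its
marginals); `h8` LSW 2004 Thm. 4.7 (SLE₈ trace); `hne` Rohde–Schramm Thm. 5.1 (SLE_κ trace,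
`κ ≠ 8`); `htr` RS Thm. 7.1 (transience); `hsc` Jordan–Schoenflies (Jordan domains are simply
connected); `hRM` Riemann mapping theorem, disc form; `hC` Carathéodory's theorem, disc form
(Pommerenke Thm. 2.6); `hscale` SLE scaling in law (RS §2 / Lawler Prop. 6.5); `h₆` RS Thm. 6.1
(SLE_κ is simple for `κ ≤ 4`); and the two theorems of the paper, `hU` (uniqueness of the
restriction family carried by simple curves: Prop. 3.3, Lemma 3.2, Thm. 7.3, Cor. 8.6) and `h₄`
(restriction property of SLE_{8/3}: Thm. 6.1). All the glue — existence and uniqueness in law of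
chordal SLE in a Dobrushin domain, boundary behaviour of uniformizing maps, Borel measurability
of simplicity — is proved in the tree (`SLEExistence`, `SLEProofs`, `HalfPlaneAutomorphism`,
`CaratheodoryHalfPlane`, `SimpleCurves`, `ConformalRestrictionProofs`).
[cite: LawlerSchrammWerner2003Restriction, p. 5 result 2] -/
theorem LawlerSchrammWerner2003_of_printed_facts (hW : Process.isProjectiveLimit_preWienerMeasure)
    (h8 : hasSLETrace_eight) (hne : hasSLETrace_of_ne_eight) (htr : tendsto_norm_sleTrace_atTop)
    (hsc : ∀ D : JordanDomain, D.isSimplyConnected)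
    (hRM : ∀ {U : Set ℂ}, exists_conformalEquiv_ball (U := U))
    (hC : JordanDomain.exists_continuousOn_extension) (hscale : identDistrib_sleTrace_scale)
    (h₆ : RandomPlanarGeometry.ae_isSimpleTrace_sleTrace_of_le_four (κ := (8 : ℝ≥0) / 3))
    (hU : LawlerSchrammWerner2003_unique) (h₄ : IsSLELaw.hullRestriction_eightThirds) :
    LawlerSchrammWerner2003 :=
  LawlerSchrammWerner2003_of_facts hW
    (exists_isSLECurve_of_disc_facts h8 hne htr hsc hRM hC
      (aemeasurable_sleTrace_of_identDistrib hscale))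
    hU
    (IsSLECurve.map_eq_of_facts
      (MarkedDomain.IsChordalUniformizing.exists_eq_trans_smul_of_disc hC) hscale
      (JordanDomain.continuousOn_boundaryExtension_of_disc hC))
    h₄ (JordanDomain.exists_hasBoundaryValue_of_disc hC) h₆
    (JordanDomain.mapsTo_boundaryExtension_of_disc hC) CurveClass.measurableSet_simple_holds

end Literature.Probability.RandomPlanarGeometry

end
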